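import Literature.AlgebraicGeometry.Frobenioids.IsometricPreStepsPushforward
import Mathlib.CategoryTheory.Whiskering
import HarnessLib

/-!
# Frobenioids I, Proposition 1.13 (Rigidity and Slimness)

Mochizuki, *The geometry of Frobenioids I: the general theory*, Kyushu J. Math. **62** (2008)
293–400, §1, Proposition 1.13 and its proof, kurims text pp. 39–40
[cite: MochizukiFrdI2008, Prop. 1.13]. Standing data: `C → F_Φ` a Frobenioid (`hF`), `A ∈ Ob(C)`,
and "the category `D` is slim [cf. §0]".

> "(i) The composite `C_A → D` of the natural functor `C_A → C` with the natural projection functor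
> `C → D` is rigid [cf. §0]. In particular, the functor `C → D` is rigid.
> (ii) The composite `C_A → F_Φ` of the natural functor `C_A → C` with the functor `C → F_Φ` is
> rigid. In particular, the functor `C → F_Φ` is rigid.
> (iii) Suppose, moreover, that every object `A ∈ Ob(C)` satisfies [at least] one of the
> following two conditions: (a) `O^×(A)^{imtr-pre} = {1}` [cf. Proposition 1.9, (ii)];
> (b) `⋂_{n ∈ N_{≥1}} {O^×(A)}^n = {1}`, and, moreover, there exists a co-angular pre-step `B → A`
> [which, by Definition 1.3, (iii), (c), induces a bijection `O^×(B) ⥲ O^×(A)`] such that `B` is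
> quasi-Frobenius-trivial and Frobenius-normalized. Then the category `C` is slim."

Everything is PROVED along the printed proof (p. 40): (i) an automorphism of `C_A → D` restricts,
along `C^pl-bk_X → C_X → C_A`, to an automorphism of `C^pl-bk_X → D_{X_D} → D`, where the first
functor is an equivalence (Def. 1.3 (i)(c)) and the second is rigid (`D` slim); (ii) by (i) and the
sharpness of `Φ`; (iii) by (i) the components of an automorphism of `C_A → C` lie in `O^×(−)`, by
functoriality along isometric pre-steps in `O^×(−)^{imtr-pre}`, and by functoriality along the
base-identity endomorphisms of a quasi-Frobenius-trivial Frobenius-normalized `B` together with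
Def. 1.3 (iii)(c) in `⋂_n (O^×)^n`.

Renderings (recorded for the referee). `C_A → C` is `Over.forget A`, `C → D` is `baseFunctor F`,
`C → F_Φ` is `F`; rigidity is `IsRigidFunctor` (§0 p. 14). In (iii)(b), "`⋂_n {O^×(A)}^n = {1}`"
is rendered as: an element of `O^×(A)` which is an `n`-th power in `O^×(A)` for every `n ≥ 1` is
trivial. Remark 1.13.1 (non-slim one-object Frobenioids) is not treated in this file.
No statement of the paper is strengthened.
-/

namespace Literature.AlgebraicGeometry.Frobenioids

open CategoryTheory Opposite

universe w v v' u u' v₁ v₂ v₃ u₁ u₂ u₃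

/-! ### Rigidity and equivalences (the key step of the proof of (i)) -/

section Rigid

variable {P : Type u₁} [Category.{v₁} P] {Q : Type u₂} [Category.{v₂} Q]
  {Z : Type u₃} [Category.{v₃} Z]

/-- Precomposing a rigid functor with (the functor of) an equivalence of categories yields a rigid
functor: whiskering along an equivalence is fully faithful on functor categories, so an
automorphism of `E ⋙ G` comes from one of `G` (used on p. 40: "`C^pl-bk_A → D_{A_D}` is an
equivalence … Thus `α` determines an automorphism of the natural functor `D_{A_D} → D`, which is
necessarily trivial, since `D` is slim"). [cite: MochizukiFrdI2008, Prop. 1.13 p.40] -/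
theorem IsRigidFunctor.equivalence_comp (e : P ≌ Q) {G : Q ⥤ Z} (hG : IsRigidFunctor G) :
    IsRigidFunctor (e.functor ⋙ G) := by
  intro α
  let W : (Q ⥤ Z) ⥤ (P ⥤ Z) := (e.congrLeft (E := Z)).inverse
  let hW : W.FullyFaithful := (e.congrLeft (E := Z)).fullyFaithfulInverse
  let β : G ≅ G := hW.preimageIso α
  have hβ : β = Iso.refl G := hG β
  have : α = W.mapIso β := (hW.isoEquiv.apply_symm_apply α).symm
  rw [this, hβ]
  ext p
  rfl

/-- Precomposing a rigid functor with an equivalence yields a rigid functor.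
[cite: MochizukiFrdI2008, Prop. 1.13 p.40] -/
theorem IsRigidFunctor.comp_of_isEquivalence (T : P ⥤ Q) [T.IsEquivalence] {G : Q ⥤ Z}
    (hG : IsRigidFunctor G) : IsRigidFunctor (T ⋙ G) :=
  IsRigidFunctor.equivalence_comp T.asEquivalence hG

end Rigid

namespace PreFrobenioid

variable {D : Type u} [Category.{v} D] {Φ : Dᵒᵖ ⥤ CommMonCat.{w}}
  {C : Type u'} [Category.{v'} C] {F : C ⥤ ElemFrobenioid Φ}

/-! ### Proposition 1.13 (i) -/

/-- The heart of **Prop. 1.13 (i)**: for an automorphism `α` of `C_A → D`, the component at an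
object `γ : X → A` is the identity (restrict `α` along `C^pl-bk_X → C_X → C_A`; the resulting
automorphism of `C^pl-bk_X → D_{X_D} → D` is trivial by Def. 1.3 (i)(c) and the slimness of `D`;
evaluate at `id_X` and transport along the identity of `X`). [cite: MochizukiFrdI2008, Prop. 1.13(i) p.40] -/
theorem app_eq_id_of_iso_sliceBase (hF : IsFrobenioid F) (hD : IsSlim D) {A : C}
    (α : Over.forget A ⋙ baseFunctor F ≅ Over.forget A ⋙ baseFunctor F) (U : Over A) :
    α.hom.app U = 𝟙 _ := by
  -- the induced automorphism `β` of `C^pl-bk_X → D_{X_D} → D`, `X := U.left`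
  let T := pullbackSliceToBase F U.left
  haveI : T.IsEquivalence := hF.i_c U.left
  let G := Over.forget ((wideSubcategoryInclusion (pullbackMorphisms F) ⋙ baseFunctor F).obj ⟨U.left⟩)
  let toA : Over (⟨U.left⟩ : PullbackCat F) → Over A := fun W => Over.mk (W.hom.1 ≫ U.hom)
  have toA_w : ∀ {W W' : Over (⟨U.left⟩ : PullbackCat F)} (m : W ⟶ W'),
      m.left.1 ≫ (toA W').hom = (toA W).hom := by
    intro W W' m
    show m.left.1 ≫ W'.hom.1 ≫ U.hom = W.hom.1 ≫ U.hom
    rw [← Category.assoc]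
    exact congrArg (· ≫ U.hom) (congrArg InducedWideCategory.Hom.hom (Over.w m))
  let β : T ⋙ G ≅ T ⋙ G := NatIso.ofComponents (fun W => α.app (toA W)) (by
    intro W W' m
    exact α.hom.naturality (X := toA W) (Y := toA W') (Over.homMk m.left.1 (toA_w m)))
  have hβ : β = Iso.refl _ :=
    IsRigidFunctor.comp_of_isEquivalence T (hD.isRigid_forget _) β
  -- evaluate at the identity of `X`
  let W₀ : Over (⟨U.left⟩ : PullbackCat F) :=
    Over.mk (Y := (⟨U.left⟩ : PullbackCat F)) (𝟙 (⟨U.left⟩ : PullbackCat F))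
  set a₀ : baseObj F U.left ⟶ baseObj F U.left := α.hom.app (toA W₀) with ha₀
  have h₀ : a₀ = 𝟙 _ := congrArg (fun i : T ⋙ G ≅ T ⋙ G => i.hom.app W₀) hβ
  -- transport along the identity `toA W₀ → U`
  let m₀ : toA W₀ ⟶ U := Over.homMk (𝟙 U.left) (by
    show 𝟙 U.left ≫ U.hom = 𝟙 U.left ≫ U.hom
    rfl)
  set a : baseObj F U.left ⟶ baseObj F U.left := α.hom.app U with ha
  have hn : Base F (𝟙 U.left) ≫ a = a₀ ≫ Base F (𝟙 U.left) := α.hom.naturality m₀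
  rw [base_id, Category.id_comp, Category.comp_id] at hn
  rw [hn, h₀]
  rfl

/-- **Prop. 1.13 (i)**: if `D` is slim then `C_A → C → D` is rigid, for every `A`.
[cite: MochizukiFrdI2008, Prop. 1.13(i) p.40] -/
theorem isRigidFunctor_sliceBase (hF : IsFrobenioid F) (hD : IsSlim D) (A : C) :
    IsRigidFunctor (Over.forget A ⋙ baseFunctor F) := by
  intro α
  ext U
  exact app_eq_id_of_iso_sliceBase hF hD α U

/-- **Prop. 1.13 (i)**, "In particular, the functor `C → D` is rigid."
[cite: MochizukiFrdI2008, Prop. 1.13(i) p.40] -/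
theorem isRigidFunctor_baseFunctor (hF : IsFrobenioid F) (hD : IsSlim D) :
    IsRigidFunctor (baseFunctor F) := by
  intro α
  ext X
  exact app_eq_id_of_iso_sliceBase hF hD (Functor.isoWhiskerLeft (Over.forget X) α) (Over.mk (𝟙 X))

/-! ### Proposition 1.13 (ii) -/

/-- An automorphism of an object of `F_Φ` with trivial base component is trivial when `Φ(A)` is
sharp ("Since `Φ` is divisorial, hence, in particular, sharp …, it thus follows that all of these
automorphisms are trivial", p. 40). [cite: MochizukiFrdI2008, Prop. 1.13(ii) p.40] -/
theorem ElemFrobenioid_iso_hom_eq_id_of_base {A : ElemFrobenioid Φ}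
    (hA : IsSharp (Φ.obj (op A.base))) (i : A ≅ A) (hb : ElemFrobenioid.Base i.hom = 𝟙 _) :
    i.hom = 𝟙 A := by
  have hlin : ElemFrobenioid.degFr i.hom = 1 := isLinear_of_isIso (𝟭 (ElemFrobenioid Φ)) i.hom
  have hunit : IsUnit (ElemFrobenioid.Div i.hom) := isUnit_div_of_isIso (𝟭 (ElemFrobenioid Φ)) i.hom
  exact ElemFrobenioid.Hom.ext hb (hA.eq_one_of_isUnit _ hunit) hlin

/-- **Prop. 1.13 (ii)**: if `D` is slim then `C_A → C → F_Φ` is rigid (by (i) the components of an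
automorphism project to identities of `D`; automorphisms in `F_Φ` over identities are trivial by
sharpness). [cite: MochizukiFrdI2008, Prop. 1.13(ii) p.40] -/
theorem isRigidFunctor_sliceFunctor (hF : IsFrobenioid F) (hD : IsSlim D) (A : C) :
    IsRigidFunctor (Over.forget A ⋙ F) := by
  intro α
  ext U
  let i : F.obj U.left ≅ F.obj U.left := α.app U
  have hb : ElemFrobenioid.Base i.hom = 𝟙 _ :=
    app_eq_id_of_iso_sliceBase hF hD (Functor.isoWhiskerRight α (ElemFrobenioid.baseFunctor Φ)) U
  exact ElemFrobenioid_iso_hom_eq_id_of_base (hF.isPreFrobenioid.isDivisorial _).isSharp i hb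

/-- **Prop. 1.13 (ii)**, "In particular, the functor `C → F_Φ` is rigid."
[cite: MochizukiFrdI2008, Prop. 1.13(ii) p.40] -/
theorem isRigidFunctor_functor (hF : IsFrobenioid F) (hD : IsSlim D) : IsRigidFunctor F := by
  intro α
  ext X
  have h := isRigidFunctor_sliceFunctor hF hD X (Functor.isoWhiskerLeft (Over.forget X) α)
  exact congrArg (fun i : Over.forget X ⋙ F ≅ Over.forget X ⋙ F => i.hom.app (Over.mk (𝟙 X))) h

/-! ### Proposition 1.13 (iii) -/

/-- Hypothesis (b) of Prop. 1.13 (iii) for an object `X`: "`⋂_n {O^×(X)}^n = {1}`, and there is a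
co-angular pre-step `B → X` with `B` quasi-Frobenius-trivial and Frobenius-normalized".
[cite: MochizukiFrdI2008, Prop. 1.13(iii) p.40] -/
structure SlimHypothesisB (F : C ⥤ ElemFrobenioid Φ) (X : C) : Prop where
  /-- an element of `O^×(X)` that is an `n`-th power in `O^×(X)` for every `n ≥ 1` is trivial -/
  eq_one_of_forall_pow : ∀ v : Aut X, v ∈ unitsSubgroup F X →
    (∀ n : ℕ+, ∃ u : Aut X, u ∈ unitsSubgroup F X ∧ u ^ (n : ℕ) = v) → v = 1
  /-- a co-angular pre-step from a quasi-Frobenius-trivial, Frobenius-normalized object -/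
  exists_preStep : ∃ (B : C) (p : B ⟶ X), IsCoAngularPreStep F p ∧ IsQuasiFrobeniusTrivial F B ∧
    IsFrobeniusNormalized F B

/-- The component of an automorphism of `C_A → C` at `U`, as an automorphism of `U.left`.
[cite: MochizukiFrdI2008, Prop. 1.13(iii) p.40] -/
def autApp {A : C} (α : Over.forget A ≅ Over.forget A) (U : Over A) : Aut U.left where
  hom := α.hom.app U
  inv := α.inv.app U
  hom_inv_id := α.hom_inv_id_app U
  inv_hom_id := α.inv_hom_id_app U

/-- Naturality of the components along a morphism of `C_A`. [cite: MochizukiFrdI2008, Prop. 1.13(iii) p.40] -/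
theorem autApp_naturality {A : C} (α : Over.forget A ≅ Over.forget A) {U V : Over A} (m : V ⟶ U) :
    (autApp α V).hom ≫ m.left = m.left ≫ (autApp α U).hom :=
  (α.hom.naturality m).symm

/-- In the proof of (iii): the components of an automorphism of `C_A → C` are base-identity
automorphisms (by (i)), i.e. lie in `O^×(−)`. [cite: MochizukiFrdI2008, Prop. 1.13(iii) p.40] -/
theorem autApp_mem_unitsSubgroup (hF : IsFrobenioid F) (hD : IsSlim D) {A : C}
    (α : Over.forget A ≅ Over.forget A) (U : Over A) : autApp α U ∈ unitsSubgroup F U.left :=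
  ⟨app_eq_id_of_iso_sliceBase hF hD (Functor.isoWhiskerRight α (baseFunctor F)) U,
    isLinear_of_isIso F (autApp α U).hom⟩

/-- In the proof of (iii): by functoriality along isometric pre-steps, the component of an
automorphism of `C_A → C` at `γ : X → A` lies in `O^×(X)^{imtr-pre}`.
[cite: MochizukiFrdI2008, Prop. 1.13(iii) p.40] -/
theorem autApp_mem_unitsSubgroupImtrPre (hF : IsFrobenioid F) (hD : IsSlim D) {A : C}
    (α : Over.forget A ≅ Over.forget A) (U : Over A) :
    autApp α U ∈ unitsSubgroupImtrPre (F := F) hF.isPreFrobenioid U.left := by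
  rw [mem_unitsSubgroupImtrPre_iff hF]
  refine ⟨autApp_mem_unitsSubgroup hF hD α U, fun Y ι _ => ?_⟩
  let V : Over A := Over.mk (ι ≫ U.hom)
  let m : V ⟶ U := Over.homMk ι rfl
  exact ⟨autApp α V, autApp_naturality α m⟩

/-- In the proof of (iii), case (b): by functoriality along the base-identity endomorphisms of a
quasi-Frobenius-trivial Frobenius-normalized `B` and the bijection `O^×(B) ⥲ O^×(X)` of
Def. 1.3 (iii)(c), the component at `γ : X → A` is an `n`-th power in `O^×(X)` for every `n`,
hence trivial. [cite: MochizukiFrdI2008, Prop. 1.13(iii) p.40] -/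
theorem autApp_eq_one_of_slimHypothesisB (hF : IsFrobenioid F) (hD : IsSlim D) {A : C}
    (α : Over.forget A ≅ Over.forget A) (U : Over A) (hX : SlimHypothesisB F U.left) :
    autApp α U = 1 := by
  have hC := hF.isPreFrobenioid.isTotallyEpimorphic
  obtain ⟨B, p, hp, hqft, hnorm⟩ := hX.exists_preStep
  refine hX.eq_one_of_forall_pow _ (autApp_mem_unitsSubgroup hF hD α U) fun n => ?_
  -- the objects `p ≫ γ` and `f ≫ p ≫ γ` of `C_A`, `f` a base-identity endomorphism of degree `n`
  obtain ⟨f, hfb, hfd⟩ := hqft n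
  let V : Over A := Over.mk (p ≫ U.hom)
  let V' : Over A := Over.mk (f ≫ p ≫ U.hom)
  let mp : V ⟶ U := Over.homMk p rfl
  let mf : V' ⟶ V := Over.homMk f rfl
  have hw : (autApp α V).hom ≫ p = p ≫ (autApp α U).hom := autApp_naturality α mp
  have hw' : (autApp α V').hom ≫ f = f ≫ (autApp α V).hom := autApp_naturality α mf
  have hV : autApp α V ∈ unitsSubgroup F B := autApp_mem_unitsSubgroup hF hD α V
  have hV' : autApp α V' ∈ unitsSubgroup F B := autApp_mem_unitsSubgroup hF hD α V'
  -- Frobenius-normalized: `f ≫ w'^n = w' ≫ f = f ≫ w`, so `w = w'^n` (`f` is an epimorphism)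
  let w : endSubmonoid F B := ⟨(autApp α V).hom, hV⟩
  let w' : endSubmonoid F B := ⟨(autApp α V').hom, hV'⟩
  have hnf : f ≫ (((w' ^ (n : ℕ)) : endSubmonoid F B).1 : B ⟶ B) = (w'.1 : B ⟶ B) ≫ f := by
    have := hnorm f hfb w'.1 w'.2
    rw [hfd] at this
    exact this
  haveI := hC.epi f
  have hww : w = w' ^ (n : ℕ) := by
    apply Subtype.ext
    have h1 : f ≫ (w.1 : B ⟶ B) = f ≫ (((w' ^ (n : ℕ)) : endSubmonoid F B).1 : B ⟶ B) := by
      rw [hnf]; exact hw'.symm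
    exact (cancel_epi f).mp h1
  -- transport along `p` by Def. 1.3 (iii)(c): `e w = α_U` (uniqueness by epi), and `e` is a
  -- homomorphism, so `α_U = (e w')^n`
  obtain ⟨e, he⟩ := hF.iii_c p hp
  have hev : ∀ b : endSubmonoid F B, (b.1 : B ⟶ B) ≫ p = p ≫ ((e b).1 : U.left ⟶ U.left) :=
    fun b => (he b).symm
  haveI := hC.epi p
  have heU : @Eq (U.left ⟶ U.left) (e w).1 (autApp α U).hom := by
    rw [← cancel_epi p, ← hev]
    exact hw
  -- `e w'` is a unit of `End X`; let `u` be the corresponding automorphism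
  have hunit' : IsUnit w' :=
    ⟨⟨w', ⟨(autApp α V').inv, (unitsSubgroup F B).inv_mem hV'⟩, Subtype.ext (autApp α V').inv_hom_id,
      Subtype.ext (autApp α V').hom_inv_id⟩, rfl⟩
  have hunit : IsUnit ((e w').1 : End U.left) := by
    obtain ⟨z, hz⟩ := hunit'.map e
    exact ⟨⟨z.1.1, z.2.1, congrArg Subtype.val z.3, congrArg Subtype.val z.4⟩, congrArg Subtype.val hz⟩
  obtain ⟨z, hz⟩ := hunit
  let u : Aut U.left := Aut.unitsEndEquivAut U.left z
  have hu : u.hom = (e w').1 := hz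
  refine ⟨u, ?_, ?_⟩
  · show IsBaseIdentity F u.hom ∧ IsLinear F u.hom
    rw [hu]; exact (e w').2
  · apply Iso.ext
    show (u ^ (n : ℕ)).hom = (autApp α U).hom
    rw [← heU, hww, map_pow, SubmonoidClass.coe_pow, ← hu]
    -- `(u ^ n).hom = u.hom ^ n` in `End`
    exact map_pow (Aut.toEnd U.left) u (n : ℕ)

/-- **Prop. 1.13 (iii)**: if `D` is slim and every object satisfies (a) `O^×(A)^{imtr-pre} = {1}`
or (b) [`⋂_n {O^×(A)}^n = {1}` and a co-angular pre-step from a quasi-Frobenius-trivial,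
Frobenius-normalized object], then `C` is slim. [cite: MochizukiFrdI2008, Prop. 1.13(iii) p.40] -/
theorem isSlim (hF : IsFrobenioid F) (hD : IsSlim D)
    (h : ∀ X : C, unitsSubgroupImtrPre (F := F) hF.isPreFrobenioid X = ⊥ ∨ SlimHypothesisB F X) :
    IsSlim C := by
  refine ⟨fun A α => ?_⟩
  ext U
  show (autApp α U).hom = (1 : Aut U.left).hom
  rcases h U.left with ha | hb
  · have hmem := autApp_mem_unitsSubgroupImtrPre hF hD α U
    rw [ha, Subgroup.mem_bot] at hmem
    rw [hmem]
  · rw [autApp_eq_one_of_slimHypothesisB hF hD α U hb]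

end PreFrobenioid

end Literature.AlgebraicGeometry.Frobenioids
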